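import Summits.MatrixMultiplication.MatrixMultiplication.Theses.ToricBorderRank
import Summits.MatrixMultiplication.MatrixMultiplication.Theorems.ToricBorderRankToricDegeneration
import Literature.Computability.AlgebraicComplexity.CoppersmithWinograd1982Acceleration
import Literature.Computability.AlgebraicComplexity.SchoenhageTauDischarge
import Literature.Computability.AlgebraicComplexity.MatrixMultiplicationConjectureForms
import Literature.Computability.AlgebraicComplexity.TensorRestrictionRank

/-!
# Crux `ToricExponentTwo` (stmt-MatrixMultiplication-9962) — strategist's typed companion to
`STRATEGY-CENSUS.md`

Every statement named in the census is a `def … : Prop` here, and every cheap implication the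
census relies on is PROVED here (no `sorry`).  Nothing in this file is a route item; it is evidence.

* §0  `crux_iff_summit` — the crux is exactly `ω(ℂ) = 2` (⇒ the route's `closes` with the proved
  `ToricDegeneration`; ⇐ zero weights and `T := ⟨N,N,N⟩`, via `exists_tensorRank_matMulTensor_lt_rpow`).
* §1  the SANDWICH: an honest decomposition is a toric parent for EVERY admissible weight
  (`isToricParent_self`), and a toric parent is a border decomposition (`ToricDegeneration`); so every
  "toric witnesses of exponent `2 + ε` exist" statement sits between the honest and the border form of
  `ω = 2`, which coincide (Bini, `Blaser2013_thm66_holds`, in tree).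
* §D1 `BorderExponentTwo` (border-rank exponent two) `↔ MatrixMultiplication`, and the tempting split
  `BorderRankIsToric → BorderExponentTwo → ToricExponentTwo` (assembly genuine, piece ≡ summit).
* §D2 `ToricTauFamily` (a parametric family of toric direct-sum identities with Schönhage root → 2/3)
  `↔ MatrixMultiplication` (⇒ Schönhage's τ-theorem `Blaser2013_thm75_holds`; ⇐ one block, zero weights).
* §D3 `ChamberExponentTwo Λ` (witnesses confined to ANY prescribed family of admissible weights)
  `↔ MatrixMultiplication`.
* §D6 the finite seeds cap: `BorderRankIsToric ∧ ThreeCubedTwenty` certify only `ω ≤ log₃ 20`.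
-/

set_option linter.dupNamespace false
set_option linter.unusedVariables false

noncomputable section

open scoped BigOperators
open Literature.Computability.AlgebraicComplexity
open Summit.MatrixMultiplication.MatrixMultiplication.Theses.ToricBorderRank

namespace Summit.MatrixMultiplication.MatrixMultiplication.Cruxes.ToricExponentTwo.Strategist

/-! ## §0 Frame: the crux is the summit -/

/-- The toric-parent predicate of the route, (W0) ∧ (W1). -/
def IsToricParent {ι κ μ : Type*} (M T : ι → κ → μ → ℂ) (α : ι → ℤ) (β : κ → ℤ) (γ : μ → ℤ) :
    Prop :=
  (∀ a b c, M a b c ≠ 0 → α a + β b + γ c = 0) ∧ (∀ a b c, α a + β b + γ c ≤ 0 → T a b c = M a b c)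

/-- §1 SANDWICH, lower slice: an honest tensor is its own toric parent for EVERY weight system
satisfying (W0) — in particular for the zero weights. -/
theorem isToricParent_self {ι κ μ : Type*} (M : ι → κ → μ → ℂ) (α : ι → ℤ) (β : κ → ℤ)
    (γ : μ → ℤ) (h0 : ∀ a b c, M a b c ≠ 0 → α a + β b + γ c = 0) : IsToricParent M M α β γ :=
  ⟨h0, fun _ _ _ _ => rfl⟩

theorem isToricParent_self_zero {ι κ μ : Type*} (M : ι → κ → μ → ℂ) :
    IsToricParent M M 0 0 0 :=
  isToricParent_self M 0 0 0 fun _ _ _ _ => by simp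

/-- (⇒) the route's deciding theorem with the PROVED degeneration lemma plugged in. -/
theorem crux_imp_summit : ToricExponentTwo → _root_.MatrixMultiplication := fun h =>
  closes h Summit.MatrixMultiplication.MatrixMultiplication.Theorems.toricDegeneration_proof

/-- (⇐) zero weights: `ω(ℂ) = 2 < 2 + ε` gives `N ≥ 2` with `R(⟨N,N,N⟩) < N^(2+ε)`
(`exists_tensorRank_matMulTensor_lt_rpow`), and `⟨N,N,N⟩` is its own toric parent. -/
theorem summit_imp_crux : _root_.MatrixMultiplication → ToricExponentTwo := by
  intro hS ε hε
  have hω : omega ℂ < 2 + ε := by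
    have h2 : omega ℂ = 2 := hS
    rw [h2]; linarith
  obtain ⟨N, hN, hlt⟩ := exists_tensorRank_matMulTensor_lt_rpow ℂ hω
  exact ⟨N, hN, 0, 0, 0, matMulTensor ℂ N N N, fun _ _ _ _ => by simp, fun _ _ _ _ => rfl, hlt.le⟩

/-- The crux is EXACTLY the summit statement. -/
theorem crux_iff_summit : ToricExponentTwo ↔ _root_.MatrixMultiplication :=
  ⟨crux_imp_summit, summit_imp_crux⟩

/-! ## §D1 Border-rank exponent two (the route's own seam `Q* ∧ (bR-exponent 2)`) -/

/-- Piece D1-b: the border-rank exponent of `⟨N,N,N⟩` is `2`. -/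
def BorderExponentTwo : Prop :=
  ∀ ε : ℝ, 0 < ε → ∃ N : ℕ, 2 ≤ N ∧
    (algBorderRank (matMulTensor ℂ N N N) : ℝ) ≤ (N : ℝ) ^ (2 + ε)

/-- D1 assembly (genuine, ~10 lines): `Q*` turns the border bound at format `N` into a toric parent of
the same rank. -/
theorem d1_assembly : BorderRankIsToric → BorderExponentTwo → ToricExponentTwo := by
  intro hQ hB ε hε
  obtain ⟨N, hN, hbr⟩ := hB ε hε
  obtain ⟨α, β, γ, T, h0, h1, hT⟩ :=
    hQ N N N (algBorderRank (matMulTensor ℂ N N N)) le_rfl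
  refine ⟨N, hN, α, β, γ, T, h0, h1, ?_⟩
  calc (tensorRank T : ℝ) ≤ (algBorderRank (matMulTensor ℂ N N N) : ℝ) := by exact_mod_cast hT
    _ ≤ (N : ℝ) ^ (2 + ε) := hbr

/-- D1-b ⇒ summit (Bini, `Blaser2013_thm66_holds.cubic`, exactly as in `closes`). -/
theorem borderExponentTwo_imp_summit : BorderExponentTwo → _root_.MatrixMultiplication := by
  intro hB
  show omega ℂ = 2
  refine le_antisymm ?_ (omega_two_le ℂ)
  refine le_of_forall_pos_le_add fun ε hε => ?_
  obtain ⟨N, hN, hbr⟩ := hB ε hε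
  set r : ℕ := max (algBorderRank (matMulTensor ℂ N N N)) 1 with hr
  have hr1 : 1 ≤ r := le_max_right _ _
  have hbr' : algBorderRank (matMulTensor ℂ N N N) ≤ r := le_max_left _ _
  have hω : omega ℂ ≤ Real.logb N r := Blaser2013_thm66_holds.cubic ℂ hN hr1 hbr'
  have hN1 : (1 : ℝ) < N := by exact_mod_cast (lt_of_lt_of_le (by norm_num) hN)
  have hNpow : (1 : ℝ) ≤ (N : ℝ) ^ (2 + ε) := Real.one_le_rpow hN1.le (by linarith)
  have hrle : (r : ℝ) ≤ (N : ℝ) ^ (2 + ε) := by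
    rcases le_total (algBorderRank (matMulTensor ℂ N N N)) 1 with h | h
    · have : r = 1 := by rw [hr]; exact max_eq_right h
      rw [this]; simpa using hNpow
    · have : r = algBorderRank (matMulTensor ℂ N N N) := by rw [hr]; exact max_eq_left h
      rw [this]; exact hbr
  have hrpos : (0 : ℝ) < r := by exact_mod_cast hr1
  calc omega ℂ ≤ Real.logb N r := hω
    _ ≤ Real.logb N ((N : ℝ) ^ (2 + ε)) := Real.logb_le_logb_of_le hN1 hrpos hrle
    _ = 2 + ε := Real.logb_rpow (by linarith) (ne_of_gt hN1)

/-- summit ⇒ D1-b (`bR ≤ R`). -/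
theorem summit_imp_borderExponentTwo : _root_.MatrixMultiplication → BorderExponentTwo := by
  intro hS ε hε
  have hω : omega ℂ < 2 + ε := by
    have h2 : omega ℂ = 2 := hS
    rw [h2]; linarith
  obtain ⟨N, hN, hlt⟩ := exists_tensorRank_matMulTensor_lt_rpow ℂ hω
  refine ⟨N, hN, le_trans ?_ hlt.le⟩
  exact_mod_cast algBorderRank_le_tensorRank (matMulTensor ℂ N N N)

/-- D1-b is EQUIVALENT to the summit: violates (c). -/
theorem borderExponentTwo_iff_summit : BorderExponentTwo ↔ _root_.MatrixMultiplication :=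
  ⟨borderExponentTwo_imp_summit, summit_imp_borderExponentTwo⟩

/-! ## §D2 A parametric toric family with Schönhage root → 2/3 (the route's two-layer plan) -/

/-- Piece D2-a: for every `δ > 0` a direct sum `⊕ᵢ ⟨kᵢ,mᵢ,nᵢ⟩` with a TORIC parent of rank `≤ r`,
`r > p`, whose Schönhage root `τ` (`∑ (kᵢmᵢnᵢ)^τ = r`) has `3τ ≤ 2 + δ`. -/
def ToricTauFamily : Prop :=
  ∀ δ : ℝ, 0 < δ → ∃ (p : ℕ) (k m n : Fin p → ℕ) (r : ℕ) (τ : ℝ), p < r ∧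
    (∃ (α : (Σ i, Fin (k i) × Fin (n i)) → ℤ) (β : (Σ i, Fin (k i) × Fin (m i)) → ℤ)
       (γ : (Σ i, Fin (m i) × Fin (n i)) → ℤ)
       (T : (Σ i, Fin (k i) × Fin (n i)) → (Σ i, Fin (k i) × Fin (m i)) →
         (Σ i, Fin (m i) × Fin (n i)) → ℂ),
       (∀ a b c, matMulDirectSum ℂ k m n a b c ≠ 0 → α a + β b + γ c = 0) ∧
       (∀ a b c, α a + β b + γ c ≤ 0 → T a b c = matMulDirectSum ℂ k m n a b c) ∧
       tensorRank T ≤ r) ∧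
    (∑ i, ((k i * m i * n i : ℕ) : ℝ) ^ τ) = r ∧ 3 * τ ≤ 2 + δ

/-- D2-a ⇒ summit: toric ⇒ border (`ToricDegeneration`, proved) ⇒ `ω ≤ 3τ ≤ 2 + δ` (Schönhage's
τ-theorem `Blaser2013_thm75_holds`, proved in tree). -/
theorem toricTauFamily_imp_summit : ToricTauFamily → _root_.MatrixMultiplication := by
  intro hF
  refine matrixMultiplication_iff_omega_le_two.2 (le_of_forall_pos_le_add fun δ hδ => ?_)
  obtain ⟨p, k, m, n, r, τ, hpr, ⟨α, β, γ, T, h0, h1, hT⟩, hτ, h3τ⟩ := hF δ hδ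
  have hbr : algBorderRank (matMulDirectSum ℂ k m n) ≤ r :=
    (Summit.MatrixMultiplication.MatrixMultiplication.Theorems.toricDegeneration_proof ℂ _ _ _
      (matMulDirectSum ℂ k m n) T α β γ h0 h1).trans hT
  have hω : omega ℂ ≤ 3 * τ := Blaser2013_thm75_holds ℂ p k m n r hpr hbr τ hτ
  linarith

/-- summit ⇒ D2-a: one block `⟨N,N,N⟩`, zero weights, `r := R(⟨N,N,N⟩)`, `τ := log_{N³} r`. -/
theorem summit_imp_toricTauFamily : _root_.MatrixMultiplication → ToricTauFamily := by
  intro hS δ hδ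
  have hω : omega ℂ < 2 + δ := by
    have h2 : omega ℂ = 2 := hS
    rw [h2]; linarith
  obtain ⟨N, hN, hlt⟩ := exists_tensorRank_matMulTensor_lt_rpow ℂ hω
  set r : ℕ := tensorRank (matMulTensor ℂ N N N) with hr
  have hN1 : (1 : ℝ) < N := by exact_mod_cast (lt_of_lt_of_le (by norm_num) hN)
  have hN0 : (0 : ℝ) < N := by linarith
  have hr4 : 4 ≤ r := by
    have h := matMulTensor_sq_le_tensorRank ℂ N
    have h4 : 4 ≤ N ^ 2 := by nlinarith
    exact h4.trans h
  have hrpos : (0 : ℝ) < r := by exact_mod_cast (lt_of_lt_of_le (by norm_num) hr4)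
  -- the block data: p = 1, k = m = n = N
  refine ⟨1, fun _ => N, fun _ => N, fun _ => N, r, Real.logb ((N : ℝ) ^ (3 : ℕ)) r, ?_, ?_, ?_, ?_⟩
  · exact lt_of_lt_of_le (by norm_num) hr4
  · -- zero weights, T := the one-block direct sum itself; its rank is R(⟨N,N,N⟩) = r
    refine ⟨0, 0, 0, matMulDirectSum ℂ (fun _ => N) (fun _ => N) (fun _ => N),
      fun _ _ _ _ => by simp, fun _ _ _ _ => rfl, ?_⟩
    rw [hr, ← approxRank_zero, ← approxRank_zero]
    rw [matMulDirectSum_one_block]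
    exact approxRank_precomp_le 0 (matMulTensor ℂ N N N)
      (fun a : (Σ _ : Fin 1, Fin N × Fin N) => a.2)
      (fun b : (Σ _ : Fin 1, Fin N × Fin N) => b.2) (fun c : (Σ _ : Fin 1, Fin N × Fin N) => c.2)
  · -- the Schönhage root of one block: (N³)^{log_{N³} r} = r
    have hN3 : (1 : ℝ) < (N : ℝ) ^ (3 : ℕ) := by
      have : (1 : ℝ) < (N : ℝ) ^ (1 : ℕ) := by simpa using hN1
      exact lt_of_lt_of_le this (pow_le_pow_right₀ hN1.le (by norm_num))
    have hcast : ((N * N * N : ℕ) : ℝ) = (N : ℝ) ^ (3 : ℕ) := by push_cast; ring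
    simp only [Finset.univ_unique, Fin.default_eq_zero, Finset.sum_singleton, hcast]
    exact Real.rpow_logb (by positivity) (ne_of_gt hN3) hrpos
  · -- 3 log_{N³} r = log_N r < 2 + δ
    have hlogN : 0 < Real.log N := Real.log_pos hN1
    have hlog3 : Real.logb ((N : ℝ) ^ (3 : ℕ)) r = Real.logb N r / 3 := by
      rw [Real.logb, Real.logb, Real.log_pow]; push_cast; field_simp
    rw [hlog3]
    have : Real.logb N r < 2 + δ := (Real.logb_lt_iff_lt_rpow hN1 hrpos).2 hlt
    linarith

/-- D2-a is EQUIVALENT to the summit: violates (c). -/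
theorem toricTauFamily_iff_summit : ToricTauFamily ↔ _root_.MatrixMultiplication :=
  ⟨toricTauFamily_imp_summit, summit_imp_toricTauFamily⟩

/-! ## §D3 Witnesses confined to a prescribed family of weights (chambers) -/

/-- A prescription of admissible weight systems per format. -/
abbrev ChamberFamily : Type :=
  ∀ N : ℕ, (Fin N × Fin N → ℤ) → (Fin N × Fin N → ℤ) → (Fin N × Fin N → ℤ) → Prop

/-- Piece D3-a, for ANY prescription `Λ N α β γ` of which integer weights are allowed at format `N`
(e.g. one lexicographic chamber per `N`, or the `ℤ₃`-symmetric chambers): toric witnesses of exponent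
two with weights in `Λ`.  Hypothesis on `Λ`: it admits, at every `N`, at least one weight system
satisfying (W0) — true of every chamber family of the route (they consist of stabiliser weights). -/
def ChamberExponentTwo (Λ : ChamberFamily) : Prop :=
  ∀ ε : ℝ, 0 < ε → ∃ N : ℕ, 2 ≤ N ∧ ∃ (α β γ : Fin N × Fin N → ℤ)
    (T : Fin N × Fin N → Fin N × Fin N → Fin N × Fin N → ℂ), Λ N α β γ ∧
    (∀ a b c, matMulTensor ℂ N N N a b c ≠ 0 → α a + β b + γ c = 0) ∧
    (∀ a b c, α a + β b + γ c ≤ 0 → T a b c = matMulTensor ℂ N N N a b c) ∧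
    (tensorRank T : ℝ) ≤ (N : ℝ) ^ (2 + ε)

/-- D3-a ⇒ crux (forget the chamber) — so D3-a is at least the summit. -/
theorem chamberExponentTwo_imp_crux (Λ : ChamberFamily) : ChamberExponentTwo Λ → ToricExponentTwo := by
  intro h ε hε
  obtain ⟨N, hN, α, β, γ, T, -, h0, h1, hT⟩ := h ε hε
  exact ⟨N, hN, α, β, γ, T, h0, h1, hT⟩

/-- summit ⇒ D3-a whenever every format carries an admissible weight in `Λ` (honest decompositions are
toric for every admissible weight): so D3-a is EQUIVALENT to the summit — violates (c). -/
theorem summit_imp_chamberExponentTwo (Λ : ChamberFamily)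
    (hΛ : ∀ N : ℕ, 2 ≤ N → ∃ α β γ : Fin N × Fin N → ℤ, Λ N α β γ ∧
      ∀ a b c, matMulTensor ℂ N N N a b c ≠ 0 → α a + β b + γ c = 0) :
    _root_.MatrixMultiplication → ChamberExponentTwo Λ := by
  intro hS ε hε
  have hω : omega ℂ < 2 + ε := by
    have h2 : omega ℂ = 2 := hS
    rw [h2]; linarith
  obtain ⟨N, hN, hlt⟩ := exists_tensorRank_matMulTensor_lt_rpow ℂ hω
  obtain ⟨α, β, γ, hΛN, h0⟩ := hΛ N hN
  exact ⟨N, hN, α, β, γ, matMulTensor ℂ N N N, hΛN, h0, fun _ _ _ _ => rfl, hlt.le⟩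

/-! ## §D6 The finite seeds cap -/

/-- The route's finite cruxes certify a FIXED exponent only: `Q*`-free, `ThreeCubedTwenty` gives
`ω(ℂ) ≤ log₃ 20` (Bini) and nothing below; no conjunction of finitely many such seeds reaches `2`
(Coppersmith–Winograd 1982 strictness, tree `sum_rpow_two_thirds_lt_algBorderRank_matMulDirectSum`). -/
theorem threeCubedTwenty_cap : ThreeCubedTwenty → omega ℂ ≤ Real.logb 3 20 := by
  rintro ⟨α, β, γ, T, h0, h1, hT⟩
  have hbr : algBorderRank (matMulTensor ℂ 3 3 3) ≤ 20 :=
    (Summit.MatrixMultiplication.MatrixMultiplication.Theorems.toricDegeneration_proof ℂ _ _ _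
      (matMulTensor ℂ 3 3 3) T α β γ h0 h1).trans hT
  have h := Blaser2013_thm66_holds.cubic ℂ (n := 3) (r := 20) (by norm_num) (by norm_num) hbr
  exact_mod_cast h

/-! ## §D4 GIT normal form: Hilbert–Mumford half ∧ cheap tensors in the S-equivalence class -/

/-- Piece D4-b: for every `ε > 0` some tensor `T` of the format of `⟨N,N,N⟩`, `N ≥ 2`, has
`R(T) ≤ N^(2+ε)` and `⟨N,N,N⟩ ∈ cl(SL³·T)` (Euclidean closure of the `SL³`-orbit, written exactly as in
the route's `HilbertMumfordHalf`). -/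
def SEquivCheap : Prop :=
  ∀ ε : ℝ, 0 < ε → ∃ N : ℕ, 2 ≤ N ∧ ∃ T : Fin N × Fin N → Fin N × Fin N → Fin N × Fin N → ℂ,
    (tensorRank T : ℝ) ≤ (N : ℝ) ^ (2 + ε) ∧
    matMulTensor ℂ N N N ∈ closure (Set.range fun g : Matrix.SpecialLinearGroup (Fin N × Fin N) ℂ ×
      Matrix.SpecialLinearGroup (Fin N × Fin N) ℂ × Matrix.SpecialLinearGroup (Fin N × Fin N) ℂ =>
      (fun a b c => ∑ a', ∑ b', ∑ c', (g.1 : Matrix (Fin N × Fin N) (Fin N × Fin N) ℂ) a a' *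
        (g.2.1 : Matrix (Fin N × Fin N) (Fin N × Fin N) ℂ) b b' *
        (g.2.2 : Matrix (Fin N × Fin N) (Fin N × Fin N) ℂ) c c' * T a' b' c'))

/-- D4 assembly (genuine: the Hilbert–Mumford half turns orbit-closure membership into a toric parent,
and rank is invariant under the `SL³`-translation — `TensorRestrictsTo.tensorRank_le`). -/
theorem d4_assembly : HilbertMumfordHalf → SEquivCheap → ToricExponentTwo := by
  intro hHM hC ε hε
  obtain ⟨N, hN, T, hT, hmem⟩ := hC ε hε
  obtain ⟨g, α, β, γ, h0, h1⟩ := (hHM N T).1 hmem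
  refine ⟨N, hN, α, β, γ, fun a b c => ∑ a', ∑ b', ∑ c',
    (g.1 : Matrix (Fin N × Fin N) (Fin N × Fin N) ℂ) a a' *
    (g.2.1 : Matrix (Fin N × Fin N) (Fin N × Fin N) ℂ) b b' *
    (g.2.2 : Matrix (Fin N × Fin N) (Fin N × Fin N) ℂ) c c' * T a' b' c', h0, h1, ?_⟩
  have hres : TensorRestrictsTo T (fun a b c => ∑ a', ∑ b', ∑ c',
      (g.1 : Matrix (Fin N × Fin N) (Fin N × Fin N) ℂ) a a' *
      (g.2.1 : Matrix (Fin N × Fin N) (Fin N × Fin N) ℂ) b b' *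
      (g.2.2 : Matrix (Fin N × Fin N) (Fin N × Fin N) ℂ) c c' * T a' b' c') :=
    ⟨_, _, _, fun _ _ _ => rfl⟩
  calc ((tensorRank fun a b c => ∑ a', ∑ b', ∑ c',
      (g.1 : Matrix (Fin N × Fin N) (Fin N × Fin N) ℂ) a a' *
      (g.2.1 : Matrix (Fin N × Fin N) (Fin N × Fin N) ℂ) b b' *
      (g.2.2 : Matrix (Fin N × Fin N) (Fin N × Fin N) ℂ) c c' * T a' b' c' : ℕ) : ℝ)
        ≤ (tensorRank T : ℝ) := by exact_mod_cast TensorRestrictsTo.tensorRank_le hres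
    _ ≤ (N : ℝ) ^ (2 + ε) := hT

/-- summit ⇒ D4-b (`T := ⟨N,N,N⟩`, `g := 1`): D4-b is a consequence of the summit; with the THEOREM
`HilbertMumfordHalf` (⇐ half proved in tree, ⇒ half proved modulo Kempf 1978 Thm 1.4) and
`d4_assembly`/`crux_imp_summit` it is EQUIVALENT to the summit — violates (c). -/
theorem summit_imp_sEquivCheap : _root_.MatrixMultiplication → SEquivCheap := by
  intro hS ε hε
  have hω : omega ℂ < 2 + ε := by
    have h2 : omega ℂ = 2 := hS
    rw [h2]; linarith
  obtain ⟨N, hN, hlt⟩ := exists_tensorRank_matMulTensor_lt_rpow ℂ hω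
  refine ⟨N, hN, matMulTensor ℂ N N N, hlt.le, subset_closure ⟨1, ?_⟩⟩
  funext a b c
  simp [Matrix.one_apply]

/-! ## §D10 Milestone ∧ "the rest of the way" (the trivial seam) -/

/-- Piece D10-a: a toric witness of exponent `< θ` at some format (a MILESTONE; for `θ = 2.1` a
strict consequence of the summit, open, and not known to imply it). -/
def MilestoneExponent (θ : ℝ) : Prop :=
  ∃ N : ℕ, 2 ≤ N ∧ ∃ (α β γ : Fin N × Fin N → ℤ)
    (T : Fin N × Fin N → Fin N × Fin N → Fin N × Fin N → ℂ),
    (∀ a b c, matMulTensor ℂ N N N a b c ≠ 0 → α a + β b + γ c = 0) ∧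
    (∀ a b c, α a + β b + γ c ≤ 0 → T a b c = matMulTensor ℂ N N N a b c) ∧
    (tensorRank T : ℝ) < (N : ℝ) ^ θ

/-- summit ⇒ every milestone above 2. -/
theorem summit_imp_milestone {θ : ℝ} (hθ : 2 < θ) : _root_.MatrixMultiplication → MilestoneExponent θ := by
  intro hS
  have hω : omega ℂ < θ := by
    have h2 : omega ℂ = 2 := hS
    rw [h2]; exact hθ
  obtain ⟨N, hN, hlt⟩ := exists_tensorRank_matMulTensor_lt_rpow ℂ hω
  exact ⟨N, hN, 0, 0, 0, matMulTensor ℂ N N N, fun _ _ _ _ => by simp, fun _ _ _ _ => rfl, hlt⟩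

/-- A milestone certifies exactly `ω(ℂ) < θ` (toric ⇒ border, Bini) — a fixed exponent, never `2`. -/
theorem milestone_imp_omega_lt {θ : ℝ} : MilestoneExponent θ → omega ℂ < θ := by
  rintro ⟨N, hN, α, β, γ, T, h0, h1, hT⟩
  have hbr : algBorderRank (matMulTensor ℂ N N N) ≤ tensorRank T :=
    Summit.MatrixMultiplication.MatrixMultiplication.Theorems.toricDegeneration_proof ℂ _ _ _
      (matMulTensor ℂ N N N) T α β γ h0 h1
  have hN1 : (1 : ℝ) < N := by exact_mod_cast (lt_of_lt_of_le (by norm_num) hN)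
  have hRpos : 0 < tensorRank T := by
    have h4 : 4 ≤ N * N := by nlinarith
    have hb : N * N ≤ algBorderRank (matMulTensor ℂ N N N) := by
      haveI : NeZero N := ⟨by omega⟩
      simpa using
        card_le_algBorderRank_of_linearIndependent _ (linearIndependent_matMulTensor ℂ N N N)
    have := (h4.trans hb).trans hbr
    omega
  have hω : omega ℂ ≤ Real.logb N (tensorRank T) :=
    Blaser2013_thm66_holds.cubic ℂ hN hRpos hbr
  have hRpos' : (0 : ℝ) < tensorRank T := by exact_mod_cast hRpos
  exact lt_of_le_of_lt hω ((Real.logb_lt_iff_lt_rpow hN1 hRpos').2 hT)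

/-- Piece D10-b, "the rest of the way": the milestone closes the gap.  `d10_assembly` is a ONE-LINER —
the seam is trivial, violating (b); and D10-b is `MilestoneExponent θ → summit` in costume. -/
def MilestoneClosesGap (θ : ℝ) : Prop := MilestoneExponent θ → ToricExponentTwo

theorem d10_assembly (θ : ℝ) : MilestoneExponent θ → MilestoneClosesGap θ → ToricExponentTwo :=
  fun h g => g h

end Summit.MatrixMultiplication.MatrixMultiplication.Cruxes.ToricExponentTwo.Strategist

end
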